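import Literature.MathematicalPhysics.QuantumFieldTheory.OSTimeContinuation
import HarnessLib

/-!
# The time continuation (A1) for zero points

Topic `Literature/MathematicalPhysics/QuantumFieldTheory`; support file (all proved; no named
facts) for the discharge of (A1) `OS1975_exists_timeContinuation`: the degenerate case `n = 0` of
H21's statement (no points; the configuration space is a single point, the time tube is everything,
and `𝔖₀ F = 𝔖₀(𝟙) · F(pt) = ∫ 𝔖₀(𝟙) F`), so that the assembly
`OSPointAssembly.timeContinuation_of_sumBound` (`n ≥ 2`) together with the one-point case covers all
`n`. Osterwalder–Schrader II, §IV.2 Thm. 4.3 (trivial case).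

* `timeContinuation_zero` — the five conjuncts of (A1) for `n = 0`.

## References

* K. Osterwalder, R. Schrader, *Axioms for Euclidean Green's functions II*, Comm. Math. Phys.
  42 (1975) 281–305, §IV.2 Thm. 4.3. [OsterwalderSchraderCMP1975]
-/

noncomputable section

open MeasureTheory Set Filter
open _root_.Topology
open scoped SchwartzMap

namespace Literature.MathematicalPhysics.QuantumFieldTheory

open Literature.MathematicalPhysics.QuantumLattice (SchwingerFamily SpaceTime complexifyPoint euclideanPoint IsTimeOrdered succDiff)

variable {d : ℕ}

/-- **The constant test function on the one-point configuration space of zero points.** [folklore] -/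
def oneZero : 𝓢((Fin 0 → SpaceTime d), ℂ) where
  toFun := fun _ => 1
  smooth' := contDiff_const
  decay' := fun k n => ⟨‖(default : Fin 0 → SpaceTime d)‖ ^ k * ‖iteratedFDeriv ℝ n (fun _ : Fin 0 → SpaceTime d => (1 : ℂ)) default‖,
    fun x => by rw [Subsingleton.elim x default]⟩

/-- Its value. [folklore] -/
@[simp] theorem oneZero_apply (x : Fin 0 → SpaceTime d) : (oneZero : 𝓢((Fin 0 → SpaceTime d), ℂ)) x = 1 := rfl

/-- Every test function of zero points is a multiple of the constant one. [folklore] -/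
theorem eq_smul_oneZero (F : 𝓢((Fin 0 → SpaceTime d), ℂ)) : F = F default • (oneZero : 𝓢((Fin 0 → SpaceTime d), ℂ)) := by
  ext x
  rw [Subsingleton.elim x default]
  simp

/-- The integral over the configurations of zero points is the evaluation. [folklore] -/
theorem integral_fin_zero (f : (Fin 0 → SpaceTime d) → ℂ) : ∫ x, f x = f default := by
  have h : (volume : Measure (Fin 0 → SpaceTime d)) = Measure.dirac default := by
    rw [MeasureTheory.volume_pi]; exact Measure.pi_of_empty _ default
  rw [h, integral_dirac]

/-- **(A1) for `n = 0`.** [cite: OsterwalderSchraderCMP1975, §IV.2 Thm. 4.3] -/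
theorem timeContinuation_zero [NeZero d] (S : SchwingerFamily (SpaceTime d)) :
    ∃ 𝔚 : (Fin 0 → Fin (d + 1) → ℂ) → ℂ,
      ContinuousOn 𝔚 (timeTube d 0) ∧ IsTimeHolomorphicOn 𝔚 (timeTube d 0) ∧
        (∀ z ∈ timeTube d 0, ∀ a : SpaceTime d, 𝔚 (fun k => z k + complexifyPoint a) = 𝔚 z) ∧
        HasOSGrowth 𝔚 ∧
        ∀ F : 𝓢((Fin 0 → SpaceTime d), ℂ), IsTimeOrdered F →
          S 0 F = ∫ x : Fin 0 → SpaceTime d, 𝔚 (euclideanPoint x) * F x := by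
  set c : ℂ := S 0 (oneZero : 𝓢((Fin 0 → SpaceTime d), ℂ)) with hc
  refine ⟨fun _ => c, continuousOn_const, fun z _ => differentiableOn_const _, fun _ _ _ => rfl,
    ⟨‖c‖, 0, fun z _ => by simp⟩, fun F _ => ?_⟩
  rw [integral_fin_zero]
  conv_lhs => rw [eq_smul_oneZero F]
  rw [map_smul, smul_eq_mul, mul_comm]

end Literature.MathematicalPhysics.QuantumFieldTheory
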